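/-
Copyright (c) 2026. All rights reserved.
Released under Apache 2.0 license as described in the file LICENSE.
Authors: abc-iut cell, statement-typer seat abc-iut-L4-t3 (wave 1).
-/
import Literature.AnabelianGeometry.AbsoluteAnabelian.LogFrobeniusPanalocalizationCoherence
import Literature.AnabelianGeometry.AbsoluteAnabelian.LogFrobeniusPanalocalizationIdentityTelecore
import HarnessLib

/-!
# [AbsTopIII] Corollary 5.5 (vi), telecore clause: the three coherences hold at the identity panalocalization

S. Mochizuki, *Topics in absolute anabelian geometry III: global reconstruction algorithms*,
J. Math. Sci. Univ. Tokyo 22 (2015) 939–1156 [MochizukiAbsTopIII2015]; Cor 5.5 (ii) p. 130, (vi) p. 132, Def 5.1 (vi) p. 118.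

Non-vacuity companion of `LogFrobeniusPanalocalizationCoherence.lean` (this seat): the hypotheses
`CompatibleWithTelecoreData`, `OverLog`, `OverLam` of `cor55PanalocalizationTelecore_of_coherence` are jointly
satisfied, at every log-Frobenius setting `L`, by the identity panalocalization `Panalocalization.identity L`
(`LogFrobeniusPanalocalizationIdentityTelecore.lean`) — all 2-cells are unitor composites, so each coherence is a
bookkeeping identity.  HONEST LABEL: consistency witness at `L₁ = L₂`; nothing here bears on [IUTchIII] Cor. 3.12;
typed ≠ proved.
-/

set_option autoImplicit false

noncomputable section

universe u

open CategoryTheory Quiver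

namespace Literature.AnabelianGeometry.AbsoluteAnabelian

namespace Panalocalization

open DiagramOfCategories LogFrobeniusSetting

variable {Vmod : Type u} {isArc : Vmod → Bool}

/-! ## Non-vacuity: the identity panalocalization satisfies the three coherences -/

variable (L : LogFrobeniusSetting Vmod isArc)

/-- the identity panalocalization lies over `𝒳` along `log`. [cite: MochizukiAbsTopIII2015, Cor 5.5 (ii) p. 130] -/
theorem identity_overLog : (identity L).OverLog := by
  intro x
  simp only [identity, Iso.trans_hom, Iso.symm_hom, NatTrans.comp_app, Functor.leftUnitor_hom_app,
    Functor.rightUnitor_inv_app, Functor.id_map]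
  repeat (first | erw [Category.id_comp] | erw [Category.comp_id])
  rfl

/-- the identity panalocalization lies over "`λ⊞_{v,ν}` lies over `Th•[Z]`". [cite: MochizukiAbsTopIII2015, Def 5.1 (vi) p. 118] -/
theorem identity_overLam (v : Vmod) (ν : LogVertex (isArc v)) : (identity L).OverLam v ν := by
  intro x
  simp only [identity, Iso.trans_hom, Iso.symm_hom, NatTrans.comp_app, Functor.leftUnitor_hom_app,
    Functor.rightUnitor_inv_app, Functor.id_map]
  repeat (first
    | erw [Category.id_comp]
    | erw [Category.comp_id]
    | erw [(L.forget v).map_id]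
    | erw [(L.toE v).map_id])
  rfl

/-- the identity panalocalization is compatible with the telecore and contact structures (`η_{An•}` is carried to
itself; cf. abc-iut-w5-d053's `exists_self_compatibleWithTelecoreData` for an anonymous copy).
[cite: MochizukiAbsTopIII2015, Cor 5.5 (vi) p. 132] -/
theorem identity_compatibleWithTelecoreData : (identity L).CompatibleWithTelecoreData := by
  unfold CompatibleWithTelecoreData
  ext x
  simp [telecoreComparison, identity]
  repeat (first | erw [L.κAn.functor.map_id] | erw [L.φAn.map_id] | erw [Category.id_comp])
  rfl

/-- hence the hypotheses of `cor55PanalocalizationTelecore_of_coherence` are jointly satisfiable at every setting, and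
the clause holds at the identity through them. [cite: MochizukiAbsTopIII2015, Cor 5.5 (vi) p. 132] -/
theorem cor55PanalocalizationTelecore_identity_of_coherence [Nonempty Vmod] :
    (identity L).Cor55PanalocalizationTelecore :=
  (identity L).cor55PanalocalizationTelecore_of_coherence (identity_compatibleWithTelecoreData L) (identity_overLog L)
    (identity_overLam L)

end Panalocalization

end Literature.AnabelianGeometry.AbsoluteAnabelian

end
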